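import Summits.Ventures.Crystal3D.Bulk.GapDarts
import HarnessLib

/-!
# Face walks close up: every dart of the tight map returns to itself under the face successor
# (faces are cycles) — `phase2/LEAN-FACES-DESIGN.md` (F1), continued

HONEST FRAMING. Part of the venture `Summits/Ventures/Crystal3D` (cell `pub-crystal3d`, phase 2;
seat typer-bulk-2). `Bulk/GapDarts.lean` makes the face successor `faceSucc c` (`φ = σ ∘ α`) a
bijection of the finite set `darts c` for admissible configurations with `intruderDist² < 3`. Here:
iterating it from any dart stays in `darts c` and RETURNS to the dart after at most `#darts` steps
(`IsGapConfig.exists_iterate_faceSucc_eq_self`) — the face through a dart is a closed walk. The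
face itself (the orbit as a finset, its length, Euler's count) is the next brick and is NOT here.
Nothing is claimed about GAP(1.26).
-/

noncomputable section

open scoped BigOperators
open Finset

namespace Summit.Ventures.Crystal3D

variable {c : Fin 14 → EuclideanSpace ℝ (Fin 3)}

/-- Iterates of the face successor stay in the darts. -/
theorem IsGapConfig.iterate_faceSucc_mem_darts (hc : IsGapConfig c) (hD3 : intruderDist c ^ 2 < 3)
    {q : Fin 14 × Fin 14} (hq : q ∈ darts c) (n : ℕ) : (faceSucc c)^[n] q ∈ darts c := by
  induction n with
  | zero => exact hq
  | succ n ih =>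
    rw [Function.iterate_succ_apply']
    exact hc.faceSucc_mem_darts hD3 ih

/-- Iterates of the face successor are injective in the starting dart (cancellation). -/
theorem IsGapConfig.iterate_faceSucc_injOn (hc : IsGapConfig c) (hD3 : intruderDist c ^ 2 < 3)
    (n : ℕ) : Set.InjOn ((faceSucc c)^[n]) (darts c : Set (Fin 14 × Fin 14)) := by
  induction n with
  | zero => intro x _ y _ h; exact h
  | succ n ih =>
    intro x hx y hy h
    rw [Function.iterate_succ_apply', Function.iterate_succ_apply'] at h
    have hx' := hc.iterate_faceSucc_mem_darts hD3 (Finset.mem_coe.1 hx) n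
    have hy' := hc.iterate_faceSucc_mem_darts hD3 (Finset.mem_coe.1 hy) n
    exact ih hx hy (hc.faceSucc_injOn hD3 (Finset.mem_coe.2 hx') (Finset.mem_coe.2 hy') h)

/-- **Every dart returns to itself: the face walk through a dart is closed.** For an admissible
configuration with `intruderDist² < 3` and a dart `q`, some positive number `n ≤ #darts` of face
steps brings `q` back to `q`. (Pigeonhole on the `#darts + 1` iterates `φ^[0] q, …, φ^[#darts] q`,
then cancellation.) -/
theorem IsGapConfig.exists_iterate_faceSucc_eq_self (hc : IsGapConfig c)
    (hD3 : intruderDist c ^ 2 < 3) {q : Fin 14 × Fin 14} (hq : q ∈ darts c) :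
    ∃ n : ℕ, 0 < n ∧ n ≤ (darts c).card ∧ (faceSucc c)^[n] q = q := by
  classical
  -- pigeonhole: the map `k ↦ φ^[k] q` from `range (#darts + 1)` into `darts`
  have hmaps : ∀ k ∈ Finset.range ((darts c).card + 1), (faceSucc c)^[k] q ∈ darts c :=
    fun k _ => hc.iterate_faceSucc_mem_darts hD3 hq k
  have hlt : (darts c).card < (Finset.range ((darts c).card + 1)).card := by
    rw [Finset.card_range]; exact Nat.lt_succ_self _
  obtain ⟨a, ha, b, hb, hab, heq⟩ :=
    Finset.exists_ne_map_eq_of_card_lt_of_maps_to hlt hmaps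
  rw [Finset.mem_range] at ha hb
  -- WLOG `a < b`
  wlog hlt' : a < b generalizing a b
  · exact this b hb a ha hab.symm heq.symm (lt_of_le_of_ne (not_lt.1 hlt') (Ne.symm hab))
  refine ⟨b - a, Nat.sub_pos_of_lt hlt', by omega, ?_⟩
  -- cancellation: `φ^[a] (φ^[b-a] q) = φ^[b] q = φ^[a] q`
  have h1 : (faceSucc c)^[a] ((faceSucc c)^[b - a] q) = (faceSucc c)^[a] q := by
    rw [← Function.iterate_add_apply, Nat.add_sub_cancel' hlt'.le]
    exact heq.symm
  exact hc.iterate_faceSucc_injOn hD3 a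
    (Finset.mem_coe.2 (hc.iterate_faceSucc_mem_darts hD3 hq (b - a))) (Finset.mem_coe.2 hq) h1

end Summit.Ventures.Crystal3D
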